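import Summits.BirchSwinnertonDyer.BirchSwinnertonDyer.Theses.ErratumRoadFive
import Summits.BirchSwinnertonDyer.BirchSwinnertonDyer.Theorems.ErratumRoadFiveRest3NoWitnessOffLocusKolyvaginTam
import Summits.BirchSwinnertonDyer.BirchSwinnertonDyer.Theorems.ErratumRoadFiveRest3NoWitnessOffLocusSlackIndex
import HarnessLib

/-!
# Route `ErratumRoadFive` (rung K2, `p ≥ 5`), crux `RamNoErratumDataAtFive` (item stmt-BirchSwinnertonDyer-19624, REST‴)
# and its registered Tamagawa stub `stub_rest3_tam` (REST⁗): THE CRUX BY NAME from the published facts, JSW17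
# Thm. 3.3.1-mult and ONE hypothesis family — in two currencies: (i) Tamagawa-level Kolyvagin certificates `hZt`
# (W. Zhang's refined non-vanishing), (ii) Tamagawa-SLACK Heegner data `hS` (one odd Heegner datum per pair whose
# index is absorbed by the Tamagawa exponent) — OWNER'S ASSEMBLY (cell `bsd-stepL`, seat `bsd-stepL-rest-p2` g2)

`--supports stmt-BirchSwinnertonDyer-19624 --as helper`. THEOREMS ONLY (no definition, no named fact, no `sorry`);
CONDITIONAL on every displayed binder; nothing is booked; BSD is proved for no pair; no census word moves (T7).

## Context (registered skeleton `Cruxes/RamNoErratumDataAtFive/Lines/birth.lean`, planner g25)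

The crux REST‴ — route p2's open input `P2OpenInputOnTreeAt W p` at every (ram) pair carrying NO erratum datum — is cut
along the Tamagawa product into `stub_rest3_locus` (`p ∤ ∏ c_ℓ`, conditional-closed on the Kolyvagin hypothesis `hZα`,
seat g0's `rest3Locus_of_kolyvaginSharpAlpha`, p447940) and `stub_rest3_tam` (REST⁗ = REST‴ ∧ `p ∣ ∏ c_ℓ`; class-wide
22 480 pairs `N < 5·10⁵` = (T) 3 687 ⊔ (NW)∩Tam 18 793). The ACCEL seat nw1 typed the (NW)∩Tam supplier
(`stub_nw_offLocus_of_kolyvaginTamFramesHL_of_thm331Mult`, p462313: a Kolyvagin certificate of level `M+1`,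
`M ≤ t := ord_p ∏ c_ℓ`, at the Hoffstein–Luo frames — `hZt`) and the per-pair Tamagawa-SLACK tool
(`openInputOnTreeAt_of_slackIndexAt_of_thm331Mult`, p462332: ONE odd Heegner datum with `ord_p [E(K):ℤP] ≤ t` gives
the open input at the pair, STEP L `2·ord_p[E(K):ℤP] ≤ ord_p #Ш(E/K) + 2t` being then free). This file is the owner's
assembly at the level of the PARENT crux and of its registered stub, in both currencies.

## What this file proves

* §1 `rest3Tam_of_kolyvaginTamFramesHL_of_thm331Mult` — the registered signature of `stub_rest3_tam` VERBATIM from the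
  published named facts (`hGZ hKo hSk hGZK hmod hnf hHL hMaz hrec`), McCallum (`hMc`), Darmon Thm. 3.6 (`h36`), JSW17
  Thm. 3.3.1-mult (`h331`) and `hZt` asked ONLY on the REST⁗ pairs (X11b, `p ≥ 5`, `ρ̄` onto, (ram), `p ∣ ∏ c_ℓ`, no
  erratum datum); `ramNoErratumDataAtFive_of_kolyvaginTamFramesHL_of_thm331Mult` — the CRUX BY NAME from the same with
  `hZt` asked on the REST‴ pairs. By-name forms over the route's support items `PublishedInputsFive` (19066) and
  `JSWAnticyclotomicControlMult` (19626).
* §2 `rest3Tam_of_slackData_of_thm331Mult` ∕ `ramNoErratumDataAtFive_of_slackData_of_thm331Mult` — the same two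
  statements from the published facts (`hGZ hKo hSk hGZK hmod`), `h331` and `hS`: at every REST⁗ (resp. REST‴) pair ONE
  odd Heegner datum `(K, Dt, H, ι, P)` with `d_K < −4`, `p ∤ c`, `P` non-torsion and `ord_p [E(K):ℤP] ≤ ord_p ∏ c_ℓ(E)`
  (hypothesis shape; per pair a FINITE computation — the seat's census `HOME/rest/SLACK-CENSUS.md` attests such a datum at
  every one of the 22 480 REST⁗ pairs `N < 5·10⁵`, two engines). Inside: `w_K = 2` from `d_K < −4`, `L(E^{d_K},1) ≠ 0`
  from the non-torsion Heegner point (Gross–Zagier (1.1) + the product rule), a minimal model of the twist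
  (`hasGlobalMinimalModel_rat`), then nw1's tool. By-name forms over `PublishedInputsFive` + `JSWAnticyclotomicControlMult`.

HONEST FRAMING. `hZt` is conjecture-grade (refereed at good ordinary `p` only: Burungale–Castella–Grossi–Skinner, Camb.
J. Math., Thm. 2); `hS` is FALSE as a class-wide statement wherever `Ш(E)[p] ≠ 0` (Gross–Zagier ∕ Gross 1991 (2.2): the
index then carries `p` beyond the Tamagawa exponent) — it is a per-pair certificate currency, not a conjecture; on the
22 480 REST⁗ pairs `N < 5·10⁵` Cremona's `#Ш_an(E)` is prime to `p` at every pair (fold of `allbsd`: Ш_an ∈ {1, 4, 9, 16}),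
which is why a slack datum is found at each of them. Neither §1 nor §2 closes the stub or the crux.

References (locators only): [cite: McCallumLMS1991, §5 Cor. 5.6 (p. 310)] [cite: Darmon2004, Thm. 3.6]
[cite: WZhang2014, Thm. 1.1 (p. 195), Remark 5 (p. 199)] [cite: JetchevSkinnerWan2017, Thm. 3.3.1, §7.4.1 (pp. 30–31)]
[cite: Gross1991, (1.1), Thm. 1.3, (2.2)] [cite: GrossZagier1986, Thm. I.(6.3), V.§2 (p. 312)]
[cite: Skinner2016PacificMC, Thm. C (§1)] [cite: Castella2018Erratum, Thm. 1.1 (iii)–(iv), (2.4)] [cite: Cox2013, §7.A].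
-/

set_option autoImplicit false
-- the Theorems namespace of this sub repeats the summit name by design (D-0017 nested layout)
set_option linter.dupNamespace false

noncomputable section

open scoped Classical

namespace Summit.BirchSwinnertonDyer.BirchSwinnertonDyer.Theorems

open WeierstrassCurve Literature.NumberTheory.EllipticCurves
  Literature.NumberTheory.EllipticCurves.ModularForms
  Literature.NumberTheory.EllipticCurves.Rank1Residual
  Summit.BirchSwinnertonDyer.Rank1Residual Summit.BirchSwinnertonDyer.Rank1Residual.X11b
  Summit.BirchSwinnertonDyer.Rank1Residual.X11b.Three.Koly
  Summit.BirchSwinnertonDyer.BirchSwinnertonDyer.Theses.ErratumRoadFive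

/-! ## §1 Currency (i): Tamagawa-level Kolyvagin certificates `hZt` -/

/-- **`stub_rest3_tam` (crux `RamNoErratumDataAtFive`, item 19624; registered signature VERBATIM) from the
Tamagawa-refined Kolyvagin road.** For every globally minimal elliptic `W/ℚ` and prime `p` with a (ram) witness, NO
erratum datum (no odd non-split `E[p]`-ramified multiplicative `q ≠ p` together with `E(ℚ_p)[p] = 0`) and
`p ∣ ∏_ℓ c_ℓ(E)` (REST⁗, cw 22 480 pairs `N < 5·10⁵`): route p2's open input `P2OpenInputOnTreeAt W p` — from the
published named facts, McCallum's structure theorem (`hMc`), Darmon Thm. 3.6 at conductor 1 (`h36`), the JSW17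
Thm. 3.3.1-mult control fact (`h331`), and ONE hypothesis-shaped input `hZt` asked ONLY on these pairs: at every
Manin-good conductor-1 frame `(Dt, β, ι)` of every Hoffstein–Luo field (`d_K` odd, Heegner for `N_E`, `L(E^{d_K},1) ≠ 0`,
`d_K ≠ −3`) of an X11b pair with `p ≥ 5`, `ρ̄_{E,p}` onto, a (ram) witness, `p ∣ ∏ c_ℓ` and no erratum datum, a
Kolyvagin certificate of some level `M + 1` with `M ≤ ord_p ∏_ℓ c_ℓ(E)` (`Koly.CertificateAt Dt β ι p M`; W. Zhang's
refined non-vanishing `M_∞ ≤ t` — OPEN at `p ∥ N`). Inside the open input's binders the pair is in X11b with `p ≥ 5` and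
`ρ̄` onto, so nw1's pair-level kernel `openInputOnTreeAt_of_kolyvaginTamFramesHLAt` applies with the seam discharged by
`h36` and the control identity by `h331`. Covers (T) and (NW)∩Tam alike. CONDITIONAL on every binder; nothing booked.
[cite: McCallumLMS1991, §5 Cor. 5.6 (p. 310)] [cite: Darmon2004, Thm. 3.6]
[cite: WZhang2014, Thm. 1.1 and Remark 5 (shape of `hZt`)] [cite: JetchevSkinnerWan2017, Thm. 3.3.1, §7.4.1] -/
theorem rest3Tam_of_kolyvaginTamFramesHL_of_thm331Mult
    (hGZ : ∀ (N : ℕ) [NeZero N] (W : WeierstrassCurve ℚ) (K : Type) [Field K] [NumberField K],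
      gross_zagier N W K)
    (hKo : ∀ (N : ℕ) [NeZero N] (W : WeierstrassCurve ℚ) (K : Type) [Field K] [NumberField K],
      kolyvagin N W K)
    (hSk : Skinner2016.thmC_padicValRat_bsd_rank_zero)
    (hGZK : rank_eq_analyticRank_of_analyticRank_le_one) (hmod : hasEntireLFunction_rat)
    (hnf : exists_isNewformOf) (hHL : HoffsteinLuo1997_exists_twist_L_one_ne_zero)
    (hMaz : mazur_not_dvd_maninConstant_of_odd)
    (hrec : ∀ (N : ℕ) [NeZero N] (W : WeierstrassCurve ℚ) (K : Type) [Field K] [NumberField K],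
      heegnerPointOfConductor_one_galoisConj N W K)
    (hMc : McCallum1991_pow_dvd_card_sha_primary_of_certificate)
    (h36 : ∀ (N : ℕ) [NeZero N] (W : WeierstrassCurve ℚ) (K : Type) [Field K] [NumberField K],
      phi_heegnerTau_mem_range_map_singularModuliField N W K)
    (h331 : JetchevSkinnerWan2017.thm331_anticyclotomicControl_mult)
    -- refined Kolyvagin non-vanishing, ∀-frame ♯ typing, asked ONLY on the REST⁗ pairs
    (hZt : ∀ (W : WeierstrassCurve ℚ) [W.IsElliptic] [W.IsGloballyMinimal] [NeZero (W.conductorNorm ℤ)]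
      (p : ℕ) [Fact p.Prime] (K : Type) [Field K] [NumberField K]
      (Dt : ModularParametrizationData W (W.conductorNorm ℤ)) (β : ℤ) (ι : K →+* ℂ),
      ClassX11b W p → 5 ≤ p → W.HasMultiplicativeReductionAtPrime p → Rank1Residual.Surj W p →
      Rank1Residual.Ram W p → p ∣ W.tamagawaProduct →
      ¬ ((∃ (q : ℕ) (_ : Fact q.Prime), q ≠ 2 ∧ q ≠ p ∧ Rank1Residual.Mult W q ∧
          ¬ W.HasSplitMultiplicativeReductionAtPrime q ∧ ¬ p ∣ padicValInt q W.minimalDiscriminantInt) ∧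
        (∀ P : (W.baseChange ℚ_[p]).toAffine.Point, p • P = 0 → P = 0)) →
      IsImaginaryQuadratic K → Odd (NumberField.discr K) →
      SatisfiesHeegnerHypothesis (W.conductorNorm ℤ) K →
      (W.quadraticTwist (NumberField.discr K : ℚ)).entireLFunction 1 ≠ 0 →
      NumberField.discr K ≠ -3 →
      (4 * (W.conductorNorm ℤ : ℤ)) ∣ β ^ 2 - NumberField.discr K → ¬ (p : ℤ) ∣ Dt.c →
      ∃ M : ℕ, M ≤ padicValNat p W.tamagawaProduct ∧ CertificateAt Dt β ι p M) :
    ∀ (W : WeierstrassCurve ℚ) [W.IsElliptic] [W.IsGloballyMinimal] (p : ℕ) [Fact p.Prime],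
      Literature.NumberTheory.EllipticCurves.Rank1Residual.Ram W p →
      ¬ ((∃ (q : ℕ) (_ : Fact q.Prime), q ≠ 2 ∧ q ≠ p ∧ Literature.NumberTheory.EllipticCurves.Rank1Residual.Mult W q ∧
          ¬ W.HasSplitMultiplicativeReductionAtPrime q ∧ ¬ p ∣ padicValInt q W.minimalDiscriminantInt) ∧
        (∀ P : (W.baseChange ℚ_[p]).toAffine.Point, p • P = 0 → P = 0)) →
      p ∣ W.tamagawaProduct →
      Summit.BirchSwinnertonDyer.Rank1Residual.X11b.P2OpenInputOnTreeAt W p := by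
  intro W _ _ p hp hram hno htam
  refine p2OpenInputOnTreeAt_of_imp_surj W p fun hX hp5 hs ↦ ?_
  haveI : NeZero (W.conductorNorm ℤ) := ⟨(W.conductorNorm_pos_holds).ne'⟩
  have hmult : W.HasMultiplicativeReductionAtPrime p := hX.2.2.1
  exact openInputOnTreeAt_of_kolyvaginTamFramesHLAt hGZ hKo hSk hGZK hmod hnf hHL hMaz hrec hMc
    (kolyvaginRoadThree_hKD_of_darmon36 h36) W p hX hram (p2ControlOnTreeAt_of_thm331Mult W p h331 hKo)
    (fun K _ _ Dt β ι hK hodd hHN hLt h3 hβ hc ↦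
      hZt W p K Dt β ι hX hp5 hmult hs hram htam hno hK hodd hHN hLt h3 hβ hc)

/-- **The crux `RamNoErratumDataAtFive` (item 19624) BY NAME from the Tamagawa-refined Kolyvagin road**: the published
named facts, McCallum (`hMc`), Darmon Thm. 3.6 (`h36`), JSW17 Thm. 3.3.1-mult (`h331`) and `hZt` asked ONLY on the REST‴
pairs (X11b, `p ≥ 5`, `ρ̄` onto, (ram), no erratum datum; Locus and off-Locus, (T) and (NW) alike — on the Locus
`p ∤ ∏ c_ℓ` the certificate has level `1`, i.e. it is the mod-`p` class of `hZα`, nw1's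
`kolyvaginTamCertificate_of_kolyvaginClass_one_ne_zero`) ⟹ `RamNoErratumDataAtFive`. CONDITIONAL on every binder;
`hZt` is OPEN at `p ∥ N`; nothing booked. [cite: McCallumLMS1991, §5 Cor. 5.6 (p. 310)] [cite: Darmon2004, Thm. 3.6]
[cite: WZhang2014, Thm. 1.1 and Remark 5 (shape of `hZt`)] [cite: JetchevSkinnerWan2017, Thm. 3.3.1, §7.4.1]
[cite: Castella2018Erratum, Thm. 1.1 (iii)–(iv)] -/
theorem ramNoErratumDataAtFive_of_kolyvaginTamFramesHL_of_thm331Mult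
    (hGZ : ∀ (N : ℕ) [NeZero N] (W : WeierstrassCurve ℚ) (K : Type) [Field K] [NumberField K],
      gross_zagier N W K)
    (hKo : ∀ (N : ℕ) [NeZero N] (W : WeierstrassCurve ℚ) (K : Type) [Field K] [NumberField K],
      kolyvagin N W K)
    (hSk : Skinner2016.thmC_padicValRat_bsd_rank_zero)
    (hGZK : rank_eq_analyticRank_of_analyticRank_le_one) (hmod : hasEntireLFunction_rat)
    (hnf : exists_isNewformOf) (hHL : HoffsteinLuo1997_exists_twist_L_one_ne_zero)
    (hMaz : mazur_not_dvd_maninConstant_of_odd)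
    (hrec : ∀ (N : ℕ) [NeZero N] (W : WeierstrassCurve ℚ) (K : Type) [Field K] [NumberField K],
      heegnerPointOfConductor_one_galoisConj N W K)
    (hMc : McCallum1991_pow_dvd_card_sha_primary_of_certificate)
    (h36 : ∀ (N : ℕ) [NeZero N] (W : WeierstrassCurve ℚ) (K : Type) [Field K] [NumberField K],
      phi_heegnerTau_mem_range_map_singularModuliField N W K)
    (h331 : JetchevSkinnerWan2017.thm331_anticyclotomicControl_mult)
    -- refined Kolyvagin non-vanishing, ∀-frame ♯ typing, asked ONLY on the REST‴ pairs
    (hZt : ∀ (W : WeierstrassCurve ℚ) [W.IsElliptic] [W.IsGloballyMinimal] [NeZero (W.conductorNorm ℤ)]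
      (p : ℕ) [Fact p.Prime] (K : Type) [Field K] [NumberField K]
      (Dt : ModularParametrizationData W (W.conductorNorm ℤ)) (β : ℤ) (ι : K →+* ℂ),
      ClassX11b W p → 5 ≤ p → W.HasMultiplicativeReductionAtPrime p → Rank1Residual.Surj W p →
      Rank1Residual.Ram W p →
      ¬ ((∃ (q : ℕ) (_ : Fact q.Prime), q ≠ 2 ∧ q ≠ p ∧ Rank1Residual.Mult W q ∧
          ¬ W.HasSplitMultiplicativeReductionAtPrime q ∧ ¬ p ∣ padicValInt q W.minimalDiscriminantInt) ∧
        (∀ P : (W.baseChange ℚ_[p]).toAffine.Point, p • P = 0 → P = 0)) →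
      IsImaginaryQuadratic K → Odd (NumberField.discr K) →
      SatisfiesHeegnerHypothesis (W.conductorNorm ℤ) K →
      (W.quadraticTwist (NumberField.discr K : ℚ)).entireLFunction 1 ≠ 0 →
      NumberField.discr K ≠ -3 →
      (4 * (W.conductorNorm ℤ : ℤ)) ∣ β ^ 2 - NumberField.discr K → ¬ (p : ℤ) ∣ Dt.c →
      ∃ M : ℕ, M ≤ padicValNat p W.tamagawaProduct ∧ CertificateAt Dt β ι p M) :
    RamNoErratumDataAtFive := by
  intro W _ _ p hp hram hno
  refine p2OpenInputOnTreeAt_of_imp_surj W p fun hX hp5 hs ↦ ?_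
  haveI : NeZero (W.conductorNorm ℤ) := ⟨(W.conductorNorm_pos_holds).ne'⟩
  have hmult : W.HasMultiplicativeReductionAtPrime p := hX.2.2.1
  exact openInputOnTreeAt_of_kolyvaginTamFramesHLAt hGZ hKo hSk hGZK hmod hnf hHL hMaz hrec hMc
    (kolyvaginRoadThree_hKD_of_darmon36 h36) W p hX hram (p2ControlOnTreeAt_of_thm331Mult W p h331 hKo)
    (fun K _ _ Dt β ι hK hodd hHN hLt h3 hβ hc ↦
      hZt W p K Dt β ι hX hp5 hmult hs hram hno hK hodd hHN hLt h3 hβ hc)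

/-- **The crux BY THE ROUTE'S NAMES ⟸ `hZt`**: `PublishedInputsFive` (support item 19066) + `JSWAnticyclotomicControlMult`
(19626) + `hrec` + `hMc` + `h36` + `hZt` on the REST‴ pairs ⟹ `RamNoErratumDataAtFive`. CONDITIONAL; nothing booked.
[cite: McCallumLMS1991, §5 Cor. 5.6 (p. 310)] [cite: Darmon2004, Thm. 3.6] [cite: WZhang2014, Thm. 1.1 and Remark 5]
[cite: JetchevSkinnerWan2017, Thm. 3.3.1] -/
theorem ramNoErratumDataAtFive_of_publishedInputsFive_of_kolyvaginTamFramesHL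
    (hF : PublishedInputsFive) (h331 : JSWAnticyclotomicControlMult)
    (hrec : ∀ (N : ℕ) [NeZero N] (W : WeierstrassCurve ℚ) (K : Type) [Field K] [NumberField K],
      heegnerPointOfConductor_one_galoisConj N W K)
    (hMc : McCallum1991_pow_dvd_card_sha_primary_of_certificate)
    (h36 : ∀ (N : ℕ) [NeZero N] (W : WeierstrassCurve ℚ) (K : Type) [Field K] [NumberField K],
      phi_heegnerTau_mem_range_map_singularModuliField N W K)
    (hZt : ∀ (W : WeierstrassCurve ℚ) [W.IsElliptic] [W.IsGloballyMinimal] [NeZero (W.conductorNorm ℤ)]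
      (p : ℕ) [Fact p.Prime] (K : Type) [Field K] [NumberField K]
      (Dt : ModularParametrizationData W (W.conductorNorm ℤ)) (β : ℤ) (ι : K →+* ℂ),
      ClassX11b W p → 5 ≤ p → W.HasMultiplicativeReductionAtPrime p → Rank1Residual.Surj W p →
      Rank1Residual.Ram W p →
      ¬ ((∃ (q : ℕ) (_ : Fact q.Prime), q ≠ 2 ∧ q ≠ p ∧ Rank1Residual.Mult W q ∧
          ¬ W.HasSplitMultiplicativeReductionAtPrime q ∧ ¬ p ∣ padicValInt q W.minimalDiscriminantInt) ∧
        (∀ P : (W.baseChange ℚ_[p]).toAffine.Point, p • P = 0 → P = 0)) →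
      IsImaginaryQuadratic K → Odd (NumberField.discr K) →
      SatisfiesHeegnerHypothesis (W.conductorNorm ℤ) K →
      (W.quadraticTwist (NumberField.discr K : ℚ)).entireLFunction 1 ≠ 0 →
      NumberField.discr K ≠ -3 →
      (4 * (W.conductorNorm ℤ : ℤ)) ∣ β ^ 2 - NumberField.discr K → ¬ (p : ℤ) ∣ Dt.c →
      ∃ M : ℕ, M ≤ padicValNat p W.tamagawaProduct ∧ CertificateAt Dt β ι p M) :
    RamNoErratumDataAtFive := by
  obtain ⟨hGZ, hKo, -, hSk, -, hGZK, hmod, hnf, hHL, -, hMaz, -, -, -, -⟩ := hF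
  exact ramNoErratumDataAtFive_of_kolyvaginTamFramesHL_of_thm331Mult hGZ hKo hSk hGZK hmod hnf hHL hMaz hrec hMc h36
    h331 hZt

/-! ## §2 Currency (ii): Tamagawa-slack Heegner data `hS` (one odd datum per pair, index absorbed by `∏ c_ℓ`) -/

/-- **At a pair: ONE Tamagawa-slack odd Heegner datum gives the open input** (existential packaging of nw1's
`openInputOnTreeAt_of_slackIndexAt_of_thm331Mult` with its side conditions discharged). For `(E, p)` in X11b with a
(ram) witness: if there are an imaginary quadratic `K` with `d_K` odd and `d_K < −4`, Heegner for `N_E`, a parametrisation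
datum `Dt` with `p ∤ c`, a Heegner datum `H`, an embedding `ι` and the Heegner point `P ∈ E(K)` of `(Dt, H, ι)`, NON-torsion,
with `ord_p [E(K):ℤP] ≤ ord_p ∏_ℓ c_ℓ(E)` — then `P2OpenInputOnTreeAt W p`, from Gross–Zagier, Kolyvagin, Skinner 2016
Thm. C, GZK, modularity and the JSW17 control fact. Discharged inside: `w_K = 2` (`d_K < −4`), `L(E^{d_K},1) ≠ 0` (the
Heegner point is non-torsion: Gross 1991 (1.1) and `L′(E/K,1) = L′(E,1)·L(E^{d_K},1)`), a globally minimal model of the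
twist (`hasGlobalMinimalModel_rat`). CONDITIONAL on the named facts; the datum is a per-pair CERTIFICATE; nothing booked.
[cite: Gross1991, (1.1) and Thm. 1.3] [cite: GrossZagier1986, V.§2 (p. 312)] [cite: JetchevSkinnerWan2017, Thm. 3.3.1, §7.4.1]
[cite: Skinner2016PacificMC, Thm. C (§1)] [cite: Cox2013, §7.A (w_K = 2 for d_K < −4)] -/
theorem openInputOnTreeAt_of_exists_slackDatum_of_thm331Mult
    (W : WeierstrassCurve ℚ) [W.IsElliptic] [W.IsGloballyMinimal] (p : ℕ) [Fact p.Prime]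
    [NeZero (W.conductorNorm ℤ)]
    (hGZ : ∀ (N : ℕ) [NeZero N] (W : WeierstrassCurve ℚ) (K : Type) [Field K] [NumberField K],
      gross_zagier N W K)
    (hKo : ∀ (N : ℕ) [NeZero N] (W : WeierstrassCurve ℚ) (K : Type) [Field K] [NumberField K],
      kolyvagin N W K)
    (hSk : Skinner2016.thmC_padicValRat_bsd_rank_zero)
    (hGZK : rank_eq_analyticRank_of_analyticRank_le_one) (hmod : hasEntireLFunction_rat)
    (h331 : JetchevSkinnerWan2017.thm331_anticyclotomicControl_mult)
    (hX : ClassX11b W p) (hram : Ram W p)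
    (hS : ∃ (K : Type) (_ : Field K) (_ : NumberField K)
      (Dt : ModularParametrizationData W (W.conductorNorm ℤ))
      (H : HeegnerDatum (W.conductorNorm ℤ) (NumberField.discr K)) (ι : K →+* ℂ)
      (P : (W.baseChange K).toAffine.Point),
      IsImaginaryQuadratic K ∧ Odd (NumberField.discr K) ∧ NumberField.discr K < -4 ∧
        SatisfiesHeegnerHypothesis (W.conductorNorm ℤ) K ∧
        WeierstrassCurve.Affine.Point.map ι.toRatAlgHom P = heegnerPointComplex Dt H ∧
        ¬ (p : ℤ) ∣ Dt.c ∧ ¬ IsOfFinAddOrder P ∧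
        padicValNat p (AddSubgroup.zmultiples P).index ≤ padicValNat p W.tamagawaProduct) :
    P2OpenInputOnTreeAt W p := by
  obtain ⟨K, _, _, Dt, H, ι, P, hK, hodd, hlt, hHN, hP, hc, hnt, hidx⟩ := hS
  have hp : p.Prime := Fact.out
  -- `w_K = 2` since `d_K < −4`, so `p ∤ #𝓞_K^×` (`p ≠ 2` is part of `ClassX11b`)
  have hμ : ¬ p ∣ NumberField.Units.torsionOrder K := by
    rw [Literature.NumberTheory.DiophantineGeometry.torsionOrder_eq_two_of_discr_lt hK.1 hlt]
    intro h2
    exact hX.2.1 ((Nat.prime_dvd_prime_iff_eq hp Nat.prime_two).mp h2)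
  -- `L(E^{d_K},1) ≠ 0`: the Heegner point is non-torsion (Gross 1991 (1.1)) and `L′(E/K,1) = L′(E,1)·L(E^{d_K},1)`
  have hLt : (W.quadraticTwist (NumberField.discr K : ℚ)).entireLFunction 1 ≠ 0 := by
    intro h0
    have hLK : LDerivEK W K ≠ 0 :=
      (lDerivEK_ne_zero_iff_not_isOfFinAddOrder W (W.conductorNorm ℤ) K (hGZ _ W K) hK hHN ⟨Dt, H, ι, hP⟩).mpr hnt
    rw [KrizLi2019.lDerivEK_eq_deriv_mul W K hmod (entireLFunction_one_eq_zero_of_analyticRank_eq_one hX.1), h0,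
      mul_zero] at hLK
    exact hLK rfl
  -- a globally minimal model of the twist
  have hD0 : (NumberField.discr K : ℚ) ≠ 0 := by exact_mod_cast NumberField.discr_ne_zero K
  haveI hEt : (W.quadraticTwist (NumberField.discr K : ℚ)).IsElliptic := W.isElliptic_quadraticTwist hD0
  obtain ⟨Cd, hCd⟩ := hasGlobalMinimalModel_rat_holds (W.quadraticTwist (NumberField.discr K : ℚ))
  haveI : (Cd • W.quadraticTwist (NumberField.discr K : ℚ)).IsGloballyMinimal := hCd
  exact openInputOnTreeAt_of_slackIndexAt_of_thm331Mult W p K Dt H ι P hGZ hKo hSk hGZK hmod h331 hX hram hK hodd hHN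
    hP hc hμ hLt (Cd • W.quadraticTwist (NumberField.discr K : ℚ)) Cd rfl hidx

/-- **`stub_rest3_tam` (registered signature VERBATIM) ⟸ Tamagawa-slack Heegner data on the REST⁗ pairs.** The published
named facts (Gross–Zagier, Kolyvagin, Skinner 2016 Thm. C, GZK, modularity), JSW17 Thm. 3.3.1-mult (`h331`), and `hS`: at
every X11b pair with `p ≥ 5`, `ρ̄` onto, a (ram) witness, `p ∣ ∏ c_ℓ` and no erratum datum, ONE odd Heegner datum with
`d_K < −4`, `p ∤ c`, non-torsion Heegner point and `ord_p [E(K):ℤP] ≤ ord_p ∏_ℓ c_ℓ(E)` (hypothesis shape; per pair a finite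
computation, attested on the 22 480 REST⁗ pairs `N < 5·10⁵` by the seat's census) ⟹ the open input on REST⁗. NO `p`-adic
regulator, NO preprint, NO Kolyvagin-prime computation enters. CONDITIONAL on every binder; `hS` is a certificate currency
(false class-wide wherever `Ш(E)[p] ≠ 0`); nothing booked. [cite: Gross1991, (1.1), Thm. 1.3, (2.2)]
[cite: JetchevSkinnerWan2017, Thm. 3.3.1, §7.4.1 (pp. 30–31)] [cite: Skinner2016PacificMC, Thm. C (§1)] -/
theorem rest3Tam_of_slackData_of_thm331Mult
    (hGZ : ∀ (N : ℕ) [NeZero N] (W : WeierstrassCurve ℚ) (K : Type) [Field K] [NumberField K],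
      gross_zagier N W K)
    (hKo : ∀ (N : ℕ) [NeZero N] (W : WeierstrassCurve ℚ) (K : Type) [Field K] [NumberField K],
      kolyvagin N W K)
    (hSk : Skinner2016.thmC_padicValRat_bsd_rank_zero)
    (hGZK : rank_eq_analyticRank_of_analyticRank_le_one) (hmod : hasEntireLFunction_rat)
    (h331 : JetchevSkinnerWan2017.thm331_anticyclotomicControl_mult)
    (hS : ∀ (W : WeierstrassCurve ℚ) [W.IsElliptic] [W.IsGloballyMinimal] [NeZero (W.conductorNorm ℤ)]
      (p : ℕ) [Fact p.Prime], ClassX11b W p → 5 ≤ p → Rank1Residual.Surj W p → Rank1Residual.Ram W p →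
      p ∣ W.tamagawaProduct →
      ¬ ((∃ (q : ℕ) (_ : Fact q.Prime), q ≠ 2 ∧ q ≠ p ∧ Rank1Residual.Mult W q ∧
          ¬ W.HasSplitMultiplicativeReductionAtPrime q ∧ ¬ p ∣ padicValInt q W.minimalDiscriminantInt) ∧
        (∀ P : (W.baseChange ℚ_[p]).toAffine.Point, p • P = 0 → P = 0)) →
      ∃ (K : Type) (_ : Field K) (_ : NumberField K)
        (Dt : ModularParametrizationData W (W.conductorNorm ℤ))
        (H : HeegnerDatum (W.conductorNorm ℤ) (NumberField.discr K)) (ι : K →+* ℂ)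
        (P : (W.baseChange K).toAffine.Point),
        IsImaginaryQuadratic K ∧ Odd (NumberField.discr K) ∧ NumberField.discr K < -4 ∧
          SatisfiesHeegnerHypothesis (W.conductorNorm ℤ) K ∧
          WeierstrassCurve.Affine.Point.map ι.toRatAlgHom P = heegnerPointComplex Dt H ∧
          ¬ (p : ℤ) ∣ Dt.c ∧ ¬ IsOfFinAddOrder P ∧
          padicValNat p (AddSubgroup.zmultiples P).index ≤ padicValNat p W.tamagawaProduct) :
    ∀ (W : WeierstrassCurve ℚ) [W.IsElliptic] [W.IsGloballyMinimal] (p : ℕ) [Fact p.Prime],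
      Literature.NumberTheory.EllipticCurves.Rank1Residual.Ram W p →
      ¬ ((∃ (q : ℕ) (_ : Fact q.Prime), q ≠ 2 ∧ q ≠ p ∧ Literature.NumberTheory.EllipticCurves.Rank1Residual.Mult W q ∧
          ¬ W.HasSplitMultiplicativeReductionAtPrime q ∧ ¬ p ∣ padicValInt q W.minimalDiscriminantInt) ∧
        (∀ P : (W.baseChange ℚ_[p]).toAffine.Point, p • P = 0 → P = 0)) →
      p ∣ W.tamagawaProduct →
      Summit.BirchSwinnertonDyer.Rank1Residual.X11b.P2OpenInputOnTreeAt W p := by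
  intro W _ _ p hp hram hno htam
  refine p2OpenInputOnTreeAt_of_imp_surj W p fun hX hp5 hs ↦ ?_
  haveI : NeZero (W.conductorNorm ℤ) := ⟨(W.conductorNorm_pos_holds).ne'⟩
  exact openInputOnTreeAt_of_exists_slackDatum_of_thm331Mult W p hGZ hKo hSk hGZK hmod h331 hX hram
    (hS W p hX hp5 hs hram htam hno)

/-- **The crux `RamNoErratumDataAtFive` (item 19624) BY NAME ⟸ Tamagawa-slack Heegner data on the REST‴ pairs**: the
published named facts, `h331`, and `hS` asked on every X11b pair with `p ≥ 5`, `ρ̄` onto, a (ram) witness and no erratum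
datum (Locus and off-Locus; on the Locus `ord_p ∏ c_ℓ = 0` and `hS` is the classical index certificate `p ∤ [E(K):ℤP]`).
CONDITIONAL; `hS` is a per-pair certificate currency, not a conjecture; nothing booked. [cite: Gross1991, (1.1), Thm. 1.3, (2.2)]
[cite: JetchevSkinnerWan2017, Thm. 3.3.1, §7.4.1] [cite: Skinner2016PacificMC, Thm. C (§1)] [cite: Castella2018Erratum, Thm. 1.1 (iii)–(iv)] -/
theorem ramNoErratumDataAtFive_of_slackData_of_thm331Mult
    (hGZ : ∀ (N : ℕ) [NeZero N] (W : WeierstrassCurve ℚ) (K : Type) [Field K] [NumberField K],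
      gross_zagier N W K)
    (hKo : ∀ (N : ℕ) [NeZero N] (W : WeierstrassCurve ℚ) (K : Type) [Field K] [NumberField K],
      kolyvagin N W K)
    (hSk : Skinner2016.thmC_padicValRat_bsd_rank_zero)
    (hGZK : rank_eq_analyticRank_of_analyticRank_le_one) (hmod : hasEntireLFunction_rat)
    (h331 : JetchevSkinnerWan2017.thm331_anticyclotomicControl_mult)
    (hS : ∀ (W : WeierstrassCurve ℚ) [W.IsElliptic] [W.IsGloballyMinimal] [NeZero (W.conductorNorm ℤ)]
      (p : ℕ) [Fact p.Prime], ClassX11b W p → 5 ≤ p → Rank1Residual.Surj W p → Rank1Residual.Ram W p →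
      ¬ ((∃ (q : ℕ) (_ : Fact q.Prime), q ≠ 2 ∧ q ≠ p ∧ Rank1Residual.Mult W q ∧
          ¬ W.HasSplitMultiplicativeReductionAtPrime q ∧ ¬ p ∣ padicValInt q W.minimalDiscriminantInt) ∧
        (∀ P : (W.baseChange ℚ_[p]).toAffine.Point, p • P = 0 → P = 0)) →
      ∃ (K : Type) (_ : Field K) (_ : NumberField K)
        (Dt : ModularParametrizationData W (W.conductorNorm ℤ))
        (H : HeegnerDatum (W.conductorNorm ℤ) (NumberField.discr K)) (ι : K →+* ℂ)
        (P : (W.baseChange K).toAffine.Point),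
        IsImaginaryQuadratic K ∧ Odd (NumberField.discr K) ∧ NumberField.discr K < -4 ∧
          SatisfiesHeegnerHypothesis (W.conductorNorm ℤ) K ∧
          WeierstrassCurve.Affine.Point.map ι.toRatAlgHom P = heegnerPointComplex Dt H ∧
          ¬ (p : ℤ) ∣ Dt.c ∧ ¬ IsOfFinAddOrder P ∧
          padicValNat p (AddSubgroup.zmultiples P).index ≤ padicValNat p W.tamagawaProduct) :
    RamNoErratumDataAtFive := by
  intro W _ _ p hp hram hno
  refine p2OpenInputOnTreeAt_of_imp_surj W p fun hX hp5 hs ↦ ?_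
  haveI : NeZero (W.conductorNorm ℤ) := ⟨(W.conductorNorm_pos_holds).ne'⟩
  exact openInputOnTreeAt_of_exists_slackDatum_of_thm331Mult W p hGZ hKo hSk hGZK hmod h331 hX hram
    (hS W p hX hp5 hs hram hno)

/-- **The crux BY THE ROUTE'S NAMES ⟸ Tamagawa-slack Heegner data**: `PublishedInputsFive` (support item 19066; its
Gross–Zagier, Kolyvagin, Skinner 2016 Thm. C, GZK and modularity conjuncts are used) + `JSWAnticyclotomicControlMult`
(19626) + `hS` on the REST‴ pairs ⟹ `RamNoErratumDataAtFive`. CONDITIONAL; nothing booked.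
[cite: Gross1991, (1.1), Thm. 1.3] [cite: JetchevSkinnerWan2017, Thm. 3.3.1] [cite: Skinner2016PacificMC, Thm. C (§1)] -/
theorem ramNoErratumDataAtFive_of_publishedInputsFive_of_slackData
    (hF : PublishedInputsFive) (h331 : JSWAnticyclotomicControlMult)
    (hS : ∀ (W : WeierstrassCurve ℚ) [W.IsElliptic] [W.IsGloballyMinimal] [NeZero (W.conductorNorm ℤ)]
      (p : ℕ) [Fact p.Prime], ClassX11b W p → 5 ≤ p → Rank1Residual.Surj W p → Rank1Residual.Ram W p →
      ¬ ((∃ (q : ℕ) (_ : Fact q.Prime), q ≠ 2 ∧ q ≠ p ∧ Rank1Residual.Mult W q ∧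
          ¬ W.HasSplitMultiplicativeReductionAtPrime q ∧ ¬ p ∣ padicValInt q W.minimalDiscriminantInt) ∧
        (∀ P : (W.baseChange ℚ_[p]).toAffine.Point, p • P = 0 → P = 0)) →
      ∃ (K : Type) (_ : Field K) (_ : NumberField K)
        (Dt : ModularParametrizationData W (W.conductorNorm ℤ))
        (H : HeegnerDatum (W.conductorNorm ℤ) (NumberField.discr K)) (ι : K →+* ℂ)
        (P : (W.baseChange K).toAffine.Point),
        IsImaginaryQuadratic K ∧ Odd (NumberField.discr K) ∧ NumberField.discr K < -4 ∧
          SatisfiesHeegnerHypothesis (W.conductorNorm ℤ) K ∧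
          WeierstrassCurve.Affine.Point.map ι.toRatAlgHom P = heegnerPointComplex Dt H ∧
          ¬ (p : ℤ) ∣ Dt.c ∧ ¬ IsOfFinAddOrder P ∧
          padicValNat p (AddSubgroup.zmultiples P).index ≤ padicValNat p W.tamagawaProduct) :
    RamNoErratumDataAtFive := by
  obtain ⟨hGZ, hKo, -, hSk, -, hGZK, hmod, -, -, -, -, -, -, -, -⟩ := hF
  exact ramNoErratumDataAtFive_of_slackData_of_thm331Mult hGZ hKo hSk hGZK hmod h331 hS

end Summit.BirchSwinnertonDyer.BirchSwinnertonDyer.Theorems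

end
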